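import Mathlib
import Literature.Barriers.ValiantsHypothesis.MonotoneGapDecomposition
import Literature.Barriers.ValiantsHypothesis.MonotoneGapParseTrees
import Literature.Computability.AlgebraicComplexity.ArithCircuitProofs
import Summits.ValiantsHypothesis.ValiantsHypothesis.Theorems.DivisionGapPerMultiplesHardStubTypedDecomposition
import Summits.ValiantsHypothesis.ValiantsHypothesis.Theorems.DivisionGapPerMultiplesHardStubTypedDecompositionFifth

/-!
# `DivisionGap.PerMultiplesHard` (stmt-ValiantsHypothesis-5068), line `uncharged-face-walk`:
the typed decomposition with the row-support window measured inside a row set `A`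
(stub `stub_typedDecompositionLocal`)

For a row set `A ⊆ Fin n` with `3 ≤ D ≤ a := #A`, a torus-homogeneous `g ∈ ℝ≥0[x_ij]`
(`n × n` variables; all monomials have row margins `R` and column margins `C`) with `R i ≠ 0` for
`i ∈ A` writes as `g = Σ_{t<s} a_t · b_t` with `s ≤ L(g)` (`L = complexity`) and every `a_t`
torus-homogeneous with margins `(ρ, γ)` whose LOCAL row support `k = #{i ∈ A | ρ i ≠ 0}` satisfies
`a < Dk ≤ 2a`.

Proof: the landed `(n/3, 2n/3]` version
(`Theorems/DivisionGapPerMultiplesHardStubTypedDecomposition.lean`, p89388) proves the descent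
`exists_window_operand` for an ABSTRACT subadditive measure `μ` and threshold `N`
(window `N < 3μ ≤ 2N`, inputs `3μ(xᵢ) ≤ N`, constants `μ = 0`).  Running it with the local measure
`μ = D · #(A ∩ rows ·)` (`rows p = p.vars.image Prod.fst`) and `N = 3a` gives the window
`a < D · #(A ∩ rows p_v) ≤ 2a` (`exists_window_gate_local`): the output hits every row of `A`
(`R i ≠ 0` on `A`) and `3Da > 6a`; a variable has local measure `≤ D ≤ a`.  The peeling induction
(`exists_typed_list_local`) and the final assembly are those of the parametric window version
(`Theorems/DivisionGapPerMultiplesHardStubTypedDecompositionFifth.lean`, p105314) with the local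
measure; for a typed `p_v ≠ 0` with row margins `ρ`, `{i ∈ A | ρ i ≠ 0} = A ∩ rows p_v`.
Sanity: `A = univ` is `typedDecompositionWindow`.

-- adapted from DivisionGapPerMultiplesHardStubTypedDecompositionFifth.lean (p105314)
-/

noncomputable section

-- the namespace is mandated by the crux (`Summit.ValiantsHypothesis.ValiantsHypothesis.…`)
set_option linter.dupNamespace false

open MvPolynomial Literature.Computability.AlgebraicComplexity
open scoped NNReal BigOperators
open Literature.Barriers.ValiantsHypothesis
open Literature.Computability.AlgebraicComplexity.ArithCircuit
open Summit.ValiantsHypothesis.ValiantsHypothesis.Theorems.DivisionGap.PerMultiplesHard.TypedDecomposition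

namespace Summit.ValiantsHypothesis.ValiantsHypothesis.Theorems.DivisionGap.PerMultiplesHard.TypedDecompositionLocal

section LocalRowSupport

variable {k : Type*} [CommSemiring k] {α β : Type*} [DecidableEq α] [DecidableEq β]

omit [DecidableEq β] in
/-- Counting inside `A` is subadditive along `s ⊆ t ∪ u`. [folklore] -/
theorem card_inter_le_of_subset_union (A : Finset α) {s t u : Finset α} (h : s ⊆ t ∪ u) :
    (A ∩ s).card ≤ (A ∩ t).card + (A ∩ u).card := by
  calc (A ∩ s).card ≤ (A ∩ (t ∪ u)).card :=
        Finset.card_le_card (Finset.inter_subset_inter_left h)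
    _ ≤ _ := by rw [Finset.inter_union_distrib_left]; exact Finset.card_union_le _ _

/-- Row support of a sum: `rows (p + q) ⊆ rows p ∪ rows q`. [folklore] -/
theorem image_fst_vars_add_subset (p q : MvPolynomial (α × β) k) :
    (p + q).vars.image Prod.fst ⊆ p.vars.image Prod.fst ∪ q.vars.image Prod.fst := by
  rw [← Finset.image_union]
  exact Finset.image_subset_image (vars_add_subset p q)

/-- Row support of a product: `rows (p * q) ⊆ rows p ∪ rows q`. [folklore] -/
theorem image_fst_vars_mul_subset (p q : MvPolynomial (α × β) k) :
    (p * q).vars.image Prod.fst ⊆ p.vars.image Prod.fst ∪ q.vars.image Prod.fst := by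
  rw [← Finset.image_union]
  exact Finset.image_subset_image (vars_mul p q)

/-- Local row support of a sum, counted inside `A`: subadditive. [folklore] -/
theorem card_inter_image_fst_vars_add_le (A : Finset α) (p q : MvPolynomial (α × β) k) :
    (A ∩ (p + q).vars.image Prod.fst).card ≤
      (A ∩ p.vars.image Prod.fst).card + (A ∩ q.vars.image Prod.fst).card :=
  card_inter_le_of_subset_union A (image_fst_vars_add_subset p q)

/-- Local row support of a product, counted inside `A`: subadditive. [folklore] -/
theorem card_inter_image_fst_vars_mul_le (A : Finset α) (p q : MvPolynomial (α × β) k) :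
    (A ∩ (p * q).vars.image Prod.fst).card ≤
      (A ∩ p.vars.image Prod.fst).card + (A ∩ q.vars.image Prod.fst).card :=
  card_inter_le_of_subset_union A (image_fst_vars_mul_subset p q)

/-- Local row support of a scalar multiple, counted inside `A`: non-increasing. [folklore] -/
theorem card_inter_image_fst_vars_smul_le (A : Finset α) (c : k) (p : MvPolynomial (α × β) k) :
    (A ∩ (c • p).vars.image Prod.fst).card ≤ (A ∩ p.vars.image Prod.fst).card := by
  refine Finset.card_le_card (Finset.inter_subset_inter_left (Finset.image_subset_image ?_))
  rw [smul_eq_C_mul]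
  refine (vars_mul _ _).trans ?_
  rw [vars_C, Finset.empty_union]

omit [DecidableEq β] in
/-- A variable `x_{ij}` has local row support `A ∩ {i}`, of size `≤ 1`. [folklore] -/
theorem card_inter_image_fst_vars_X_le [Nontrivial k] (A : Finset α) (e : α × β) :
    (A ∩ (X e : MvPolynomial (α × β) k).vars.image Prod.fst).card ≤ 1 :=
  (Finset.card_le_card Finset.inter_subset_right).trans (card_image_fst_vars_X e).le

omit [DecidableEq β] in
/-- A constant has empty local row support. [folklore] -/
theorem card_inter_image_fst_vars_C (A : Finset α) (c : k) :
    (A ∩ (C c : MvPolynomial (α × β) k).vars.image Prod.fst).card = 0 := by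
  rw [vars_C, Finset.image_empty, Finset.inter_empty, Finset.card_empty]

end LocalRowSupport

variable {n : ℕ}

/-- If every monomial of `g ≠ 0` has the row margins `R`, positive on the row set `A`, then every
row of `A` is hit: `A ∩ rows g = A`. [folklore] -/
theorem inter_image_fst_vars_eq (A : Finset (Fin n)) {g : MvPolynomial (Fin n × Fin n) ℝ≥0}
    {R : Fin n → ℕ} (hg : ∀ m ∈ g.support, ∀ i, ∑ j, m (i, j) = R i)
    (hR : ∀ i ∈ A, R i ≠ 0) (h0 : g ≠ 0) :
    A ∩ g.vars.image Prod.fst = A := by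
  obtain ⟨m, hm⟩ := support_nonempty.mpr h0
  refine Finset.inter_eq_left.mpr fun i hiA => ?_
  have hi : ∑ j, m (i, j) ≠ 0 := by rw [hg m hm i]; exact hR i hiA
  obtain ⟨j, -, hj⟩ := Finset.exists_ne_zero_of_sum_ne_zero hi
  exact Finset.mem_image.mpr
    ⟨(i, j), (mem_vars_iff_mem_support _).mpr ⟨m, hm, Finsupp.mem_support_iff.mpr hj⟩, rfl⟩

/-- For a typed `p ≠ 0` (all monomials have the row margins `ρ`) the rows of `A` with nonzero
margin are exactly the local row support `A ∩ rows p`. [folklore] -/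
theorem filter_ne_zero_eq_inter_image_fst_vars (A : Finset (Fin n))
    {p : MvPolynomial (Fin n × Fin n) ℝ≥0} {ρ : Fin n → ℕ}
    (hp : ∀ m ∈ p.support, ∀ i, ∑ j, m (i, j) = ρ i) (h0 : p ≠ 0) :
    (A.filter fun i => ρ i ≠ 0) = A ∩ p.vars.image Prod.fst := by
  rw [← filter_ne_zero_eq_image_fst_vars hp h0, Finset.inter_filter, Finset.inter_univ]

/-- **A gate in the local window `(a/D, 2a/D]`, `a = #A`.** If a fan-in-two circuit over `ℝ≥0`
computes a nonzero polynomial in the `n × n` variables all of whose monomials have the row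
margins `R`, positive on the row set `A`, and `3 ≤ D ≤ a`, then some gate value `p` has local row
support `k = #(A ∩ rows p)` with `a < Dk ≤ 2a`: the abstract descent `exists_window_operand` for
the measure `D · #(A ∩ rows ·)` and the threshold `3a` (the output hits every row of `A`,
`3Da > 6a`; a variable has measure `≤ D`, `3D ≤ 3a`; constants have measure `0`).
[cite: JerrumSnir1982, §3.3 (proof of Thm. 3.4)] -/
theorem exists_window_gate_local (n D : ℕ) (A : Finset (Fin n)) (hD : 3 ≤ D) (hDA : D ≤ A.card)
    (R : Fin n → ℕ) (hR : ∀ i ∈ A, R i ≠ 0) (P : ArithCircuit ℝ≥0 (Fin n × Fin n))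
    (h2 : P.IsFanInTwo) (hg : ∀ m ∈ P.eval.support, ∀ i, ∑ j, m (i, j) = R i)
    (h0 : P.eval ≠ 0) :
    ∃ v : ℕ, A.card < D * (A ∩ ((gateValues P.gates).getD v 0).vars.image Prod.fst).card ∧
      D * (A ∩ ((gateValues P.gates).getD v 0).vars.image Prod.fst).card ≤ 2 * A.card := by
  have hAeq := inter_image_fst_vars_eq A hg hR h0
  have hDA' : 3 * A.card ≤ D * A.card := Nat.mul_le_mul_right A.card hD
  have hout : 2 * (3 * A.card) < 3 * (D * (A ∩ P.eval.vars.image Prod.fst).card) := by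
    rw [hAeq]; omega
  obtain ⟨v, hlo, hhi⟩ := exists_window_operand P.gates h2
    (fun p : MvPolynomial (Fin n × Fin n) ℝ≥0 => D * (A ∩ p.vars.image Prod.fst).card)
    (3 * A.card)
    (fun p q => by
      rw [← mul_add]; exact Nat.mul_le_mul_left D (card_inter_image_fst_vars_add_le A p q))
    (fun p q => by
      rw [← mul_add]; exact Nat.mul_le_mul_left D (card_inter_image_fst_vars_mul_le A p q))
    (fun c p => Nat.mul_le_mul_left D (card_inter_image_fst_vars_smul_le A c p))
    (fun e => by
      have h := Nat.mul_le_mul_left D (card_inter_image_fst_vars_X_le (k := ℝ≥0) A e)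
      omega)
    (fun c => by rw [card_inter_image_fst_vars_C, mul_zero]) P.output hout
  exact ⟨v, by omega, by omega⟩

/-- **The peeling induction, local window `(a/D, 2a/D]`.** A fan-in-two circuit over `ℝ≥0` whose
gate values vanish outside a set `Z` of at most `N` indices and whose output is typed with
margins `(R, C)`, `R i > 0` on the row set `A` (`3 ≤ D ≤ a = #A`), writes its output as a sum of
at most `N` products `p · q`, every `p` typed with local row support `k = #{i ∈ A | ρ i ≠ 0}`,
`a < Dk ≤ 2a`: zero a window gate `v` (`exists_eval_eq_zeroAt_add`), type `p_v` through
`supp (p_v · q) ⊆ supp P.eval` when `q ≠ 0`, and recurse on `P.zeroAt v`.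
[cite: JerrumSnir1982, §3 (Lemma 3.1(iii), Thm. 3.2)] -/
theorem exists_typed_list_local (n D : ℕ) (A : Finset (Fin n)) (hD : 3 ≤ D) (hDA : D ≤ A.card)
    (R C : Fin n → ℕ) (hR : ∀ i ∈ A, R i ≠ 0) :
    ∀ (N : ℕ) (P : ArithCircuit ℝ≥0 (Fin n × Fin n)), P.IsFanInTwo →
      (∃ Z : Finset ℕ, Z.card ≤ N ∧ ∀ j ∉ Z, (gateValues P.gates).getD j 0 = 0) →
      (∀ m ∈ P.eval.support, (∀ i, ∑ j, m (i, j) = R i) ∧ (∀ j, ∑ i, m (i, j) = C j)) →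
      ∃ L : List (MvPolynomial (Fin n × Fin n) ℝ≥0 × MvPolynomial (Fin n × Fin n) ℝ≥0),
        L.length ≤ N ∧ P.eval = (L.map fun ab => ab.1 * ab.2).sum ∧
        ∀ ab ∈ L, ∃ ρ γ : Fin n → ℕ,
          (∀ m ∈ ab.1.support, (∀ i, ∑ j, m (i, j) = ρ i) ∧ (∀ j, ∑ i, m (i, j) = γ j)) ∧
          A.card < D * (A.filter fun i => ρ i ≠ 0).card ∧
          D * (A.filter fun i => ρ i ≠ 0).card ≤ 2 * A.card := by
  intro N
  induction N with
  | zero =>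
    rintro P h2 ⟨Z, hZc, hZ0⟩ hg
    by_cases h0 : P.eval = 0
    · exact ⟨[], le_rfl, by simp [h0], by simp⟩
    · exfalso
      obtain ⟨v, hlo, -⟩ :=
        exists_window_gate_local n D A hD hDA R hR P h2 (fun m hm => (hg m hm).1) h0
      have hv : (gateValues P.gates).getD v 0 = 0 :=
        hZ0 v (by simp [Finset.card_eq_zero.mp (Nat.le_zero.mp hZc)])
      rw [hv, vars_0, Finset.image_empty, Finset.inter_empty, Finset.card_empty] at hlo
      omega
  | succ N ih =>
    rintro P h2 ⟨Z, hZc, hZ0⟩ hg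
    by_cases h0 : P.eval = 0
    · exact ⟨[], by simp, by simp [h0], by simp⟩
    obtain ⟨v, hlo, hhi⟩ :=
      exists_window_gate_local n D A hD hDA R hR P h2 (fun m hm => (hg m hm).1) h0
    obtain ⟨q, hq⟩ := exists_eval_eq_zeroAt_add P v
    have hlink := linked_gateValues_set P.gates v
    set p := (gateValues P.gates).getD v 0
    have hp0 : p ≠ 0 := by
      intro h
      rw [h, vars_0, Finset.image_empty, Finset.inter_empty, Finset.card_empty] at hlo
      omega
    have hvZ : v ∈ Z := by_contra fun h => hp0 (hZ0 v h)
    -- the zeroed circuit: values vanish outside `Z.erase v`, output still typed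
    have hZ' : ∃ Z' : Finset ℕ, Z'.card ≤ N ∧
        ∀ j ∉ Z', (gateValues (P.zeroAt v).gates).getD j 0 = 0 := by
      refine ⟨Z.erase v, ?_, fun j hj => ?_⟩
      · rw [Finset.card_erase_of_mem hvZ]; omega
      · by_cases hjv : j = v
        · subst hjv; exact getD_gateValues_set_zeroGate P.gates j
        · have hjZ : j ∉ Z := fun h => hj (Finset.mem_erase.mpr ⟨hjv, h⟩)
          obtain ⟨h, hh⟩ := hlink.2 j
          rw [hZ0 j hjZ] at hh
          exact eq_zero_of_zero_eq_add hh
    have hg' : ∀ m ∈ (P.zeroAt v).eval.support,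
        (∀ i, ∑ j, m (i, j) = R i) ∧ (∀ j, ∑ i, m (i, j) = C j) :=
      fun m hm => hg m (support_subset_of_eq_add hq hm)
    obtain ⟨L, hLlen, hLsum, hLtyp⟩ := ih (P.zeroAt v) (h2.zeroAt v) hZ' hg'
    by_cases hq0 : q = 0
    · refine ⟨L, by omega, ?_, hLtyp⟩
      rw [hq, hq0, mul_zero, add_zero, hLsum]
    · have hsub : (p * q).support ⊆ P.eval.support :=
        support_subset_of_eq_add (hq.trans (add_comm _ _))
      obtain ⟨ρ, γ, hty⟩ := exists_margins_of_support_mul_subset hg hsub hq0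
      refine ⟨(p, q) :: L, by simpa using hLlen, ?_, ?_⟩
      · simp only [List.map_cons, List.sum_cons]
        rw [hq, hLsum, add_comm]
      · intro ab hab
        rcases List.mem_cons.mp hab with rfl | hab
        · refine ⟨ρ, γ, hty, ?_⟩
          rw [filter_ne_zero_eq_inter_image_fst_vars A (fun m hm => (hty m hm).1) hp0]
          exact ⟨hlo, hhi⟩
        · exact hLtyp ab hab

/-- **The typed decomposition with the local window `(a/D, 2a/D]`** (stub
`stub_typedDecompositionLocal`). For a row set `A` with `3 ≤ D ≤ a = #A`, a torus-homogeneous `g`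
over `ℝ≥0` (all monomials have margins `(R, C)`) with `R i ≠ 0` for `i ∈ A` writes as
`g = Σ_{t < s} a_t · b_t` with `s ≤ L(g)` and every `a_t` torus-homogeneous with margins `(ρ, γ)`,
`a < D · #{i ∈ A | ρ i ≠ 0} ≤ 2a`: peel (`exists_typed_list_local`) a minimal fan-in-two circuit
for `g` (`exists_computes_size_eq_complexity`) at most `size = L(g)` times.
[cite: JerrumSnir1982, §3 (Lemma 3.1(iii), Thm. 3.2, proof of Thm. 3.4)] -/
theorem stub_typedDecompositionLocal :
    ∀ (n D : ℕ) (A : Finset (Fin n)), 3 ≤ D → D ≤ A.card →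
      ∀ (g : MvPolynomial (Fin n × Fin n) ℝ≥0) (R C : Fin n → ℕ),
        (∀ m ∈ g.support, (∀ i, ∑ j, m (i, j) = R i) ∧ (∀ j, ∑ i, m (i, j) = C j)) →
        (∀ i ∈ A, R i ≠ 0) →
        ∃ s : ℕ, s ≤ complexity g ∧
          ∃ a b : Fin s → MvPolynomial (Fin n × Fin n) ℝ≥0,
            g = ∑ t, a t * b t ∧
            ∀ t, ∃ ρ γ : Fin n → ℕ,
              (∀ m ∈ (a t).support, (∀ i, ∑ j, m (i, j) = ρ i) ∧ (∀ j, ∑ i, m (i, j) = γ j)) ∧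
              A.card < D * (A.filter fun i => ρ i ≠ 0).card ∧
              D * (A.filter fun i => ρ i ≠ 0).card ≤ 2 * A.card := by
  intro n D A hD hDA g R C hg hR
  obtain ⟨P, h2, hPg, hsize⟩ := exists_computes_size_eq_complexity g
  have heval : P.eval = g := hPg
  subst heval
  have hZ : ∃ Z : Finset ℕ, Z.card ≤ P.size ∧ ∀ j ∉ Z, (gateValues P.gates).getD j 0 = 0 := by
    refine ⟨Finset.range P.size, by simp, fun j hj => getD_gateValues_eq_zero ?_⟩
    exact List.getElem?_eq_none_iff.mpr (by simpa [ArithCircuit.size] using hj)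
  obtain ⟨L, hLlen, hLsum, hLtyp⟩ :=
    exists_typed_list_local n D A hD hDA R C hR P.size P h2 hZ hg
  refine ⟨L.length, hsize ▸ hLlen, fun t => (L[t.1]).1, fun t => (L[t.1]).2, ?_,
    fun t => hLtyp _ (List.getElem_mem _)⟩
  rw [Fin.sum_univ_fun_getElem L (fun ab => ab.1 * ab.2)]
  exact hLsum

end Summit.ValiantsHypothesis.ValiantsHypothesis.Theorems.DivisionGap.PerMultiplesHard.TypedDecompositionLocal
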